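import Mathlib

/-!
# The unit monomial is transversal

Route `RadicialJung`, crux `CleanModelsSuffice`, line `Sketch`: registered stub
`stub_unitMonomialTransversal` (an ingredient of the exceptionalisation game). On the exceptional
divisor of a blow-up, at points where no charged coordinate vanishes, the residual radicand is the
unit monomial `w = ∏ T_j ^ a_j` in the fibre coordinates `T_j`. If `p ∤ a_i` for some `i`, then
`w - δ ^ p` never lies in the square of the maximal ideal of the local ring at a prime `P`
containing none of the `T_j`: adjoining a `p`-th root of `w` keeps the local ring regular.

Proof: by Euler's identity in the variable `T_i`, `T_i * ∂_i w = a_i • w`, and `a_i` is a unit in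
characteristic `p` while `w ∉ P` (`P` is prime and contains no `T_j`); hence `∂_i w ∉ P`. On the
other hand a derivation `D` maps `P ^ 2` into `P` (Leibniz) and kills `p`-th powers in
characteristic `p`. Clearing denominators, `w - δ ^ p ∈ 𝔪 ^ 2 = (P ^ 2) S[T]_P` gives
`m * (g ^ p * w - f ^ p) ∈ P ^ 2` with `m, g ∉ P`; applying `D = ∂_i` yields `g ^ p * ∂_i w ∈ P`,
hence `∂_i w ∈ P`, a contradiction.
-/

set_option linter.dupNamespace false

open IsLocalRing MvPolynomial

namespace Summit.ResolutionOfSingularities.ResolutionOfSingularities.Theorems.RadicialJung.CleanModelsSuffice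

/-- **Euler for the unit monomial.** If `P` is a prime of `S[T_1, …, T_n]` (`S` of prime
characteristic `p`) containing none of the variables and `p ∤ a_i`, then
`∂_i (∏ T_j ^ a_j) ∉ P`: indeed `T_i * ∂_i w = a_i • w` with `a_i` a unit and `w ∉ P`. -/
theorem pderiv_prod_X_pow_notMem {S : Type*} [CommRing S] (p : ℕ) (hp : p.Prime) [CharP S p]
    {n : ℕ} (P : Ideal (MvPolynomial (Fin n) S)) [hP : P.IsPrime]
    (hX : ∀ j, (MvPolynomial.X j : MvPolynomial (Fin n) S) ∉ P) (a : Fin n → ℕ) (i : Fin n)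
    (ha : ¬ p ∣ a i) : pderiv i (∏ j, X j ^ a j : MvPolynomial (Fin n) S) ∉ P := by
  classical
  intro hDw
  -- the exponent vector as a finitely supported function, and `w` as a monomial
  set s : Fin n →₀ ℕ := Finsupp.equivFunOnFinite.symm a with hs_def
  have hw : (∏ j, X j ^ a j : MvPolynomial (Fin n) S) = monomial s 1 := by
    rw [monomial_eq, C_1, one_mul, Finsupp.prod_fintype _ _ (fun _ => pow_zero _)]
    rfl
  -- `w ∉ P`
  have hwP : (∏ j, X j ^ a j : MvPolynomial (Fin n) S) ∈ P.primeCompl :=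
    Submonoid.prod_mem _ (fun j _ => Submonoid.pow_mem _ (hX j) _)
  -- Euler: `T_i * ∂_i w = a_i • w`
  have hEuler : X i * pderiv i (∏ j, X j ^ a j : MvPolynomial (Fin n) S) =
      (a i : MvPolynomial (Fin n) S) * ∏ j, X j ^ a j := by
    rw [hw, X_mul_pderiv_monomial, nsmul_eq_mul]
    rfl
  have haw : (a i : MvPolynomial (Fin n) S) * ∏ j, X j ^ a j ∈ P := by
    rw [← hEuler]
    exact P.mul_mem_left _ hDw
  have hunit : IsUnit ((a i : ℕ) : MvPolynomial (Fin n) S) :=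
    (CharP.isUnit_natCast_iff (R := MvPolynomial (Fin n) S) hp).mpr ha
  exact hwP ((Ideal.unit_mul_mem_iff_mem P hunit).mp haw)

/-- **The unit monomial is transversal.** Let `S` be a ring of prime characteristic `p`, `P` a
prime ideal of `S[T_1, …, T_n]` containing none of the variables, and `w = ∏ T_j ^ a_j` with
`p ∤ a_i` for some `i`. Then for every `δ` in the localisation at `P`, `w - δ ^ p ∉ 𝔪 ^ 2`. -/
theorem stub_unitMonomialTransversal {S : Type} [CommRing S] (p : ℕ) (hp : p.Prime) [CharP S p]
    {n : ℕ} (P : Ideal (MvPolynomial (Fin n) S)) [hP : P.IsPrime]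
    (hX : ∀ j, (MvPolynomial.X j : MvPolynomial (Fin n) S) ∉ P) (a : Fin n → ℕ) (i : Fin n)
    (ha : ¬ p ∣ a i) (δ : Localization.AtPrime P) :
    algebraMap (MvPolynomial (Fin n) S) (Localization.AtPrime P) (∏ j, MvPolynomial.X j ^ a j)
      - δ ^ p ∉ IsLocalRing.maximalIdeal (Localization.AtPrime P) ^ 2 := by
  intro hmem
  -- the derivation `D = ∂_i`, the monomial `w`, and `∂_i w ∉ P` (Euler)
  set D : Derivation S (MvPolynomial (Fin n) S) (MvPolynomial (Fin n) S) := pderiv i with hD_def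
  set w : MvPolynomial (Fin n) S := ∏ j, X j ^ a j with hw_def
  have hDw : D w ∉ P := pderiv_prod_X_pow_notMem p hp P hX a i ha
  -- a derivation maps `P ^ 2` into `P` (Leibniz) ...
  have hDsq : ∀ {x}, x ∈ P ^ 2 → D x ∈ P := fun {x} hx => by
    rw [pow_two] at hx
    refine Submodule.mul_induction_on hx (fun b hb c hc => ?_) (fun b c hb hc => ?_)
    · rw [Derivation.leibniz, smul_eq_mul, smul_eq_mul]
      exact P.add_mem (P.mul_mem_right _ hb) (P.mul_mem_right _ hc)
    · rw [map_add]
      exact P.add_mem hb hc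
  -- ... and kills `p`-th powers in characteristic `p`
  have hDpow : ∀ x, D (x ^ p) = 0 := fun x => by
    rw [Derivation.leibniz_pow, nsmul_eq_mul, CharP.cast_eq_zero _ p, zero_mul]
  -- write `δ = f / g` and clear denominators: `m * (g ^ p * w - f ^ p) ∈ P ^ 2`, `m, g ∉ P`
  obtain ⟨⟨f, g⟩, rfl⟩ := IsLocalization.mk'_surjective P.primeCompl δ
  have key : algebraMap (MvPolynomial (Fin n) S) (Localization.AtPrime P)
      ((g : MvPolynomial (Fin n) S) ^ p * w - f ^ p) ∈
      IsLocalRing.maximalIdeal (Localization.AtPrime P) ^ 2 := by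
    have := Ideal.mul_mem_left _
      ((algebraMap (MvPolynomial (Fin n) S) (Localization.AtPrime P) g) ^ p) hmem
    convert this using 1
    rw [map_sub, map_mul, map_pow, map_pow, mul_sub, ← mul_pow,
      IsLocalization.mk'_spec' (M := P.primeCompl)]
  rw [← Localization.AtPrime.map_eq_maximalIdeal, ← Ideal.map_pow,
    IsLocalization.algebraMap_mem_map_algebraMap_iff P.primeCompl] at key
  obtain ⟨m, hm, hmy⟩ := key
  set y : MvPolynomial (Fin n) S := (g : MvPolynomial (Fin n) S) ^ p * w - f ^ p with hy_def
  have hyP : y ∈ P := (hP.mem_or_mem (Ideal.pow_le_self two_ne_zero hmy)).resolve_left hm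
  -- apply `D`: `m * D y + y * D m ∈ P`, so `m * D y ∈ P`, so `D y = g ^ p * D w ∈ P`
  have hDmy : D (m * y) ∈ P := hDsq hmy
  rw [Derivation.leibniz, smul_eq_mul, smul_eq_mul] at hDmy
  have hmDy : m * D y ∈ P := by
    have := P.sub_mem hDmy (P.mul_mem_right (D m) hyP)
    rwa [add_sub_cancel_right] at this
  have hDy : D y ∈ P := (hP.mem_or_mem hmDy).resolve_left hm
  have hDy' : D y = (g : MvPolynomial (Fin n) S) ^ p * D w := by
    rw [hy_def, map_sub, Derivation.leibniz, hDpow, hDpow, smul_zero, add_zero, sub_zero,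
      smul_eq_mul]
  rw [hDy'] at hDy
  exact hDw ((hP.mem_or_mem hDy).resolve_left (Submonoid.pow_mem P.primeCompl g.2 p))

end Summit.ResolutionOfSingularities.ResolutionOfSingularities.Theorems.RadicialJung.CleanModelsSuffice
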